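import Literature.Probability.Percolation.ClusterExtremalPoints
import Literature.Probability.Percolation.RSW
import Literature.Probability.Percolation.PlanarDuality

/-!
# Stub `stub_incrementExtraction` of line `registered` (crux `SimilarityUpgrade`, stmt-CriticalPhenomena-4597)

Route `CardyWhiteToColoured`, sub-problem `CardyFormulaZ2`, crux
`Summit.CriticalPhenomena.CardyFormulaZ2.Theses.CardyWhiteToColoured.SimilarityUpgrade`, line
`registered` (skeleton `Cruxes/SimilarityUpgrade/Lines/birth.lean`), stub T1
`stub_incrementExtraction`: **the deterministic extraction on `LR(m,k) ∖ LR(m+j,k)`.**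

On a lattice configuration `ω ⊆ E(ℤ²)` with an open left–right crossing of `[0,m] × [0,k]` but
none of `[0,m+j] × [0,k]`, let `C` be the set of sites joined by an open path inside the big box
`Λ = [0,m+j] × [0,k]` to its left side, and let `p` be the top element of the finite set `C` for
the strict total order `SiteBelow (1,0)` (rightmost, then topmost; `exists_isTop_siteBelow`).

* The right end of the small crossing lies in `C` (monotonicity `openConnIn_mono`), so `m ≤ p₀`;
  no site of `C` is on the right side of `Λ` (that would be a crossing of the big box), so
  `p₀ < m + j`; and `p ∈ C ∩ Λ` gives `0 ≤ p₁ ≤ k` and the connection to the left side.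
* Local top at scale `s` (`1 ≤ s ≤ m`, `s ≤ p₁ ≤ k - s`), direction `(1,0)`:
  (a) the open path from `p` to the left side (column `0 ≤ p₀ - s`) leaves the open box
  `p + (-s,s)²`; its initial segment up to the first exit edge (`exists_walk_exit`) is a path of
  the local open graph of `p + [-s,s]²` from `p` to a site of the sphere `‖· - p‖_∞ = s`;
  (b) a site `y` joined to `p` in the local open graph is joined by a local walk all of whose
  vertices are weakly left of `p` — otherwise the first edge `f → g` crossing the column `p₀`
  has `g₀ = p₀ + 1 ≤ m + j`, the segment up to `f` and the edge lie in `Λ` (rows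
  `[p₁ - s, p₁ + s] ⊆ [0,k]`, columns `[p₀ - s, p₀ + 1] ⊆ [0, m+j]`), so `g ∈ C` strictly right of
  `p`, contradicting maximality; hence the whole walk lies in `Λ`, `y ∈ C`, and maximality of
  `p` gives `SiteBelow (1,0) y p`.

References: O. Schramm, S. Smirnov, *On the scaling limits of planar percolation*, Ann. Probab.
39 (2011), §6 (Lemma 6.1 flavour: no macroscopic cluster boundary creeps along a segment);
P. Nolin, *Near-critical percolation in two dimensions*, EJP 13 (2008), §5.2, proof of Thm 23.
No definitions are introduced; helper lemmas live in the sub-namespace `IncrementExtraction`.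
-/

noncomputable section

namespace Summit.CriticalPhenomena.CardyFormulaZ2.Cruxes.SimilarityUpgrade.Stubs

open Literature.Probability.Percolation
open Literature.Probability.LatticeModels (Site zdGraph box mem_box box_mono zero_mem_box)

namespace IncrementExtraction

variable {ω : BondConfig (Site 2)}

/-- For the direction `u = (1,0)`, a site strictly `u`-below `x` lies weakly left of `x`.
[folklore] -/
theorem apply_zero_le_of_siteBelow {y x : Site 2} (h : SiteBelow ![(1 : ℝ), 0] y x) :
    y 0 ≤ x 0 := by
  rcases h with h | ⟨-, h⟩
  · have h' : (y 0 : ℝ) < x 0 := by simpa [siteHeight] using h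
    exact_mod_cast h'.le
  · omega

/-- A walk of the open graph inside the local box `x + [-s,s]²` joins its ends in the local open
graph of that box. [folklore] -/
theorem reachable_localOpenGraph_of_walk {x : Site 2} {s : ℕ} :
    ∀ {a b : Site 2} (W : (openGraph ω).Walk a b), (∀ z ∈ W.support, z ∈ localBox x s) →
      (localOpenGraph ω x s).Reachable a b
  | _, _, SimpleGraph.Walk.nil, _ => SimpleGraph.Reachable.refl _
  | a, _, SimpleGraph.Walk.cons (v := c) h W, hW => by
    have ha : a ∈ localBox x s := hW a (by simp)
    have hc : c ∈ localBox x s := hW c (by simp)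
    have h' := (openGraph_adj ω a c).1 h
    have hadj : (localOpenGraph ω x s).Adj a c := localOpenGraph_adj.2 ⟨h'.1, ha, hc, h'.2⟩
    exact hadj.reachable.trans
      (reachable_localOpenGraph_of_walk W fun z hz ↦ hW z (by simp [hz]))

/-- The vertices of a walk of the local open graph starting in the local box lie in the local
box. [folklore] -/
theorem mem_localBox_of_mem_support {x : Site 2} {s : ℕ} :
    ∀ {a b : Site 2} (W : (localOpenGraph ω x s).Walk a b), a ∈ localBox x s →
      ∀ z ∈ W.support, z ∈ localBox x s
  | _, _, SimpleGraph.Walk.nil, ha, z, hz => by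
    rw [SimpleGraph.Walk.support_nil, List.mem_singleton] at hz
    exact hz ▸ ha
  | _, _, SimpleGraph.Walk.cons h W, ha, z, hz => by
    rw [SimpleGraph.Walk.support_cons, List.mem_cons] at hz
    rcases hz with rfl | hz
    · exact ha
    · exact mem_localBox_of_mem_support W (localOpenGraph_adj.1 h).2.2.1 z hz

/-- The edges of a walk of the local open graph are open. [folklore] -/
theorem mem_of_mem_edges {x : Site 2} {s : ℕ} {a b : Site 2}
    (W : (localOpenGraph ω x s).Walk a b) : ∀ e ∈ W.edges, e ∈ ω := fun _ he ↦
  (edgeSet_openGraph_subset (ω ∩ ↑(localEdges x s)) (W.edges_subset_edgeSet he)).1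

/-- Bookkeeping: a site of the local box `p + [-s,s]²` in a column `≤ m + j` lies in the big box
`[0, m+j] × [0, k]` as soon as `s ≤ m ≤ p₀` and `s ≤ p₁ ≤ k - s`. [folklore] -/
theorem mem_rectangle_of_mem_localBox {m j k s : ℕ} {p z : Site 2} (hsm : s ≤ m)
    (hmp : (m : ℤ) ≤ p 0) (hsp : (s : ℤ) ≤ p 1) (hpk : p 1 + s ≤ k) (hz : z ∈ localBox p s)
    (hz0 : z 0 ≤ (m : ℤ) + j) : z ∈ rectangle (m + j) k := by
  rw [mem_localBox, mem_box] at hz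
  have h0 := hz 0
  have h1 := hz 1
  simp only [Pi.sub_apply] at h0 h1
  rw [mem_rectangle_iff]
  push_cast
  omega

end IncrementExtraction

open IncrementExtraction in
/-- **stub_incrementExtraction (T1, deterministic).** On a lattice configuration having an open
left–right crossing of `[0,m]×[0,k]` but none of `[0,m+j]×[0,k]`, let `C` be the set of sites joined
inside the big box `[0,m+j]×[0,k]` to its left side and `p` the topmost of the rightmost sites of
`C`; then `m ≤ p₀ < m+j`, `p` is joined to the left side inside the big box, and for every scale
`1 ≤ s ≤ m` with `s ≤ p₁ ≤ k - s`, `p` is a local top in direction `(1,0)` at scale `s`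
(`IsLocalTop`, `ClusterExtremalPoints.lean`): its open cluster inside `p + [-s,s]²` reaches the
boundary of that box (follow the path to the left side, `p₀ - s ≥ 0`) and every other site of it is
`(1,0)`-below `p` (such a site is joined to `p` inside the big box without ever passing column
`p₀ + 1 ≤ m + j` — the first site beyond column `p₀` would be a site of `C` right of `p` — hence lies
in `C`, weakly left of `p`, and strictly below `p` if on its column).
[cite: SchrammSmirnov2011, Lemma 6.1] -/
theorem stub_incrementExtraction :
    ∀ (ω : BondConfig (Site 2)), ω ⊆ (zdGraph 2).edgeSet →
    ∀ (m j k : ℕ), ω ∈ lrCrossing m k → ω ∉ lrCrossing (m + j) k →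
      ∃ p : Site 2, (m : ℤ) ≤ p 0 ∧ p 0 < m + j ∧ 0 ≤ p 1 ∧ p 1 ≤ k ∧
        (∃ u ∈ (leftSide (m + j) k : Set (Site 2)),
          ω ∈ openConnIn (↑(rectangle (m + j) k) : Set (Site 2)) u p) ∧
        ∀ s : ℕ, 1 ≤ s → s ≤ m → (s : ℤ) ≤ p 1 → p 1 + s ≤ k →
          IsLocalTop ![(1 : ℝ), 0] ω p s := by
  classical
  intro ω hω m j k hlr hnlr
  -- the big box `Λ` and the set `C` of sites joined inside it to its left side
  set Λ : Set (Site 2) := ↑(rectangle (m + j) k) with hΛ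
  set C : Set (Site 2) :=
    {v | ∃ u ∈ (leftSide (m + j) k : Set (Site 2)), ω ∈ openConnIn Λ u v} with hC
  have hCΛ : ∀ v ∈ C, v ∈ Λ := by
    rintro v ⟨u, -, -, hv, -⟩
    exact hv
  -- no site of `C` lies on the right side of the big box
  have hC0 : ∀ v ∈ C, v 0 ≠ (m : ℤ) + j := by
    rintro v hvC hv
    obtain ⟨u, hu, huv⟩ := hvC
    refine hnlr ⟨u, hu, v, Finset.mem_coe.2 (Finset.mem_filter.2 ⟨hCΛ v ⟨u, hu, huv⟩, ?_⟩), huv⟩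
    push_cast
    exact hv
  -- (i) the right end of an open crossing of the small box lies in `C`, on the column `m`
  obtain ⟨x, hx, y, hy, hxy⟩ := hlr
  rw [Finset.mem_coe, leftSide, Finset.mem_filter] at hx
  rw [Finset.mem_coe, rightSide, Finset.mem_filter] at hy
  have hrect : (↑(rectangle m k) : Set (Site 2)) ⊆ Λ := fun z hz ↦
    Finset.mem_coe.2 (rectangle_mono (Nat.le_add_right m j) le_rfl (Finset.mem_coe.1 hz))
  have hxL : x ∈ (leftSide (m + j) k : Set (Site 2)) :=
    Finset.mem_coe.2 (Finset.mem_filter.2 ⟨rectangle_mono (Nat.le_add_right m j) le_rfl hx.1, hx.2⟩)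
  have hyC : y ∈ C := ⟨x, hxL, openConnIn_mono hrect x y hxy⟩
  -- (ii)/(iii) `C` as a finite set, and its top element `p` for the order `SiteBelow (1,0)`
  set S : Finset (Site 2) := (rectangle (m + j) k).filter (· ∈ C) with hS
  have hCS : ∀ v ∈ C, v ∈ S := fun v hv ↦
    Finset.mem_filter.2 ⟨Finset.mem_coe.1 (hCΛ v hv), hv⟩
  obtain ⟨p, hpS, hmax⟩ := exists_isTop_siteBelow ![(1 : ℝ), 0] (S := S) ⟨y, hCS y hyC⟩
  obtain ⟨hpΛ, hpC⟩ := Finset.mem_filter.1 hpS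
  have hple : ∀ v ∈ C, v 0 ≤ p 0 := fun v hv ↦ by
    by_cases hvp : v = p
    · rw [hvp]
    · exact apply_zero_le_of_siteBelow (hmax v (hCS v hv) hvp)
  rw [mem_rectangle_iff] at hpΛ
  have hmp : (m : ℤ) ≤ p 0 := hy.2.symm.le.trans (hple y hyC)
  have hpj : p 0 < (m : ℤ) + j := lt_of_le_of_ne (by push_cast at hpΛ; omega) (hC0 p hpC)
  obtain ⟨u, hu, hup⟩ := hpC
  have hu0 : u 0 = 0 := (Finset.mem_filter.1 (Finset.mem_coe.1 hu)).2
  refine ⟨p, hmp, hpj, hpΛ.2.2.1, hpΛ.2.2.2, ⟨u, hu, hup⟩, fun s hs1 hsm hsp hpk ↦ ⟨?_, ?_⟩⟩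
  · -- (a) the local cluster of `p` reaches the sphere: follow the open path towards the left side
    obtain ⟨huΛ, hpΛ', hr⟩ := hup
    have hW : (openGraph ω).Reachable p u :=
      (hr.map (SimpleGraph.Embedding.induce Λ).toHom).symm
    obtain ⟨W⟩ := hW
    have hpB : p ∈ {z : Site 2 | z - p ∈ box 2 (s - 1)} := by
      rw [Set.mem_setOf_eq, sub_self]
      exact zero_mem_box 2 (s - 1)
    have huB : u ∉ {z : Site 2 | z - p ∈ box 2 (s - 1)} := by
      rw [Set.mem_setOf_eq, mem_box, not_forall]
      refine ⟨0, fun h ↦ ?_⟩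
      simp only [Pi.sub_apply] at h
      omega
    obtain ⟨f, g, hf, hg, hadj, W', hW'⟩ := exists_walk_exit _ W hpB huB
    simp only [Set.mem_setOf_eq] at hf hg hW'
    have hfg := (openGraph_adj ω f g).1 hadj
    have hsub : ∀ z : Site 2, z - p ∈ box 2 (s - 1) → z ∈ localBox p s := fun z hz ↦
      mem_localBox.2 (box_mono 2 (Nat.sub_le s 1) hz)
    have hgbox : g - p ∈ box 2 s := by
      rw [mem_box] at hf ⊢
      intro i
      have h1 := abs_sub_le_one_of_mem hω hfg.1 i
      have h2 := hf i
      simp only [Pi.sub_apply] at h2 ⊢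
      rw [abs_le] at h1
      constructor <;> omega
    refine ⟨g, Finset.mem_sdiff.2 ⟨hgbox, hg⟩, ?_⟩
    have h1 : (localOpenGraph ω p s).Reachable p f :=
      reachable_localOpenGraph_of_walk W' fun z hz ↦ hsub z (hW' z hz)
    have h2 : (localOpenGraph ω p s).Adj f g :=
      localOpenGraph_adj.2 ⟨hfg.1, hsub f hf, mem_localBox.2 hgbox, hfg.2⟩
    exact h1.trans h2.reachable
  · -- (b) every other site of the local cluster of `p` is `(1,0)`-below `p`
    intro y' hy' hy'p
    obtain ⟨Wy⟩ := hy'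
    have hpbox : p ∈ localBox p s := mem_localBox.2 (by rw [sub_self]; exact zero_mem_box 2 s)
    have hCof : ∀ g, ω ∈ openConnIn Λ p g → g ∈ C := fun g hg ↦
      ⟨u, hu, PlanarDuality.openConnIn_trans hup hg⟩
    -- all the vertices of `Wy` are weakly left of `p`
    have hT : ∀ z ∈ Wy.support, z 0 ≤ p 0 := by
      by_contra hcon
      push Not at hcon
      obtain ⟨z, hz, hzp⟩ := hcon
      obtain ⟨f, g, hf, hg, hadj, W', hW'⟩ := exists_walk_exit {w : Site 2 | w 0 ≤ p 0}
        (Wy.takeUntil z hz) (show p 0 ≤ p 0 from le_rfl) (show ¬ z 0 ≤ p 0 from not_le.2 hzp)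
      simp only [Set.mem_setOf_eq, not_le] at hf hg hW'
      have hfg := localOpenGraph_adj.1 hadj
      have hW'box := mem_localBox_of_mem_support W' hpbox
      have hfΛ : f ∈ Λ :=
        Finset.mem_coe.2 (mem_rectangle_of_mem_localBox hsm hmp hsp hpk hfg.2.1 (by omega))
      have hg0 : g 0 ≤ p 0 + 1 := by
        have h1 := abs_sub_le_one_of_mem hω hfg.1 0
        rw [abs_le] at h1
        omega
      have hgΛ : g ∈ Λ :=
        Finset.mem_coe.2 (mem_rectangle_of_mem_localBox hsm hmp hsp hpk hfg.2.2.1 (by omega))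
      have hpf : ω ∈ openConnIn Λ p f :=
        mem_openConnIn_of_walk W'
          (fun w hw ↦ Finset.mem_coe.2 (mem_rectangle_of_mem_localBox hsm hmp hsp hpk
            (hW'box w hw) (by have := hW' w hw; omega)))
          (mem_of_mem_edges W')
      have hgC : g ∈ C :=
        hCof g (PlanarDuality.openConnIn_trans hpf (openConnIn_of_adj hfΛ hgΛ hfg.1 hfg.2.2.2))
      have hgp : g ≠ p := fun h ↦ by
        rw [h] at hg
        exact lt_irrefl _ hg
      have := apply_zero_le_of_siteBelow (hmax g (hCS g hgC) hgp)
      omega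
    have hWybox := mem_localBox_of_mem_support Wy hpbox
    have hpy : ω ∈ openConnIn Λ p y' :=
      mem_openConnIn_of_walk Wy
        (fun w hw ↦ Finset.mem_coe.2 (mem_rectangle_of_mem_localBox hsm hmp hsp hpk
          (hWybox w hw) (by have := hT w hw; omega)))
        (mem_of_mem_edges Wy)
    exact hmax y' (hCS y' (hCof y' hpy)) hy'p

end Summit.CriticalPhenomena.CardyFormulaZ2.Cruxes.SimilarityUpgrade.Stubs

end
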